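/-
Copyright (c) 2026. All rights reserved.
Released under Apache 2.0 license as described in the file LICENSE.
Authors: abc-iut cell, prover seat abc-iut-w5-d180 (wave 5, gen 4).
-/
import Literature.IUT.LogVolume.UnitLogWildDyadic
import HarnessLib

/-!
# Unramified dyadic fields with residue degree `f ≥ 2`: `log₂(𝒪_K^×)` is NOT a ball (Artin–Schreier)

Proof-only companion (theorems, no definitions) of `UnitLogWildDyadic.lean` / `UnitLogIntoMaximalIdeal.lean`.
Classical (Neukirch, *Algebraic Number Theory*, Ch. II (5.5); Serre, *Local Fields*, Ch. XIV §4 for the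
Artin–Schreier shape).  Let `K` be a complete ultrametric normed `ℚ₂`-algebra field with `e(K/ℚ₂) = 1`
(absolutely unramified), residue field `κ = 𝒪/2𝒪` of characteristic `2`.  Every principal unit is `1 − 2w`,
`‖w‖ ≤ 1`, and in `L(1 − 2w) = −Σ (2w)ⁿ/n` the terms of index `n ≥ 3` have norm `≤ 1/4`, so

  `log₂(1 − 2w) ≡ −2(w + w²) = −2·w·(1 + w)  (mod 4𝒪)`,

i.e. modulo `4𝒪` the unit logarithms are `2·℘(κ)` for the ARTIN–SCHREIER map `℘(c) = c² + c` of `κ`.  Since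
`℘(0) = ℘(1) = 0`, `℘` is never onto the finite field `κ` (`exists_not_mem_range_artinSchreier`), so some
`z ∈ 2𝒪` is no unit logarithm (`exists_norm_le_half_not_mem_logUnits`; true for every `f`); and when `f ≥ 2`
there is `c ∈ κ ∖ {0,1}`, whence a unit `w` with `1 + w` a unit and `‖log₂(1 − 2w)‖ = 1/2` EXACTLY
(`exists_norm_unitLog_eq_half`).  Consequently **`logUnits_ne_closedBall`**: for `e = 1`, `f ≥ 2` the lattice
`log₂(𝒪_K^×)` is NO ball `{‖y‖ ≤ r}` (it sits strictly between `4𝒪` and `2𝒪`), and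
**`closedBall_one_ne_zpow_smul_logUnits`**: `𝒪_K ≠ 2^k·log₂(𝒪_K^×)` for every `k ∈ ℤ`.
(For `f = 1`, i.e. `K = ℚ₂`, `log₂(ℤ₂^×) = 4ℤ₂` IS a ball — the hypothesis `f ≥ 2` is sharp.)

Consumer: the abc-iut cell's TEAM R «ismDH mover» thread — by `Thm311RealIsmDHMoverCriterion` a ball `t·𝒪_v` is
moved by Dupuy–Hilado's (Ind2) iff it is no `p^k·log_p(𝒪_v^×)`; this file supplies that at every unramified
place over `2` of residue degree `≥ 2` (item (ii) of abc-iut-w5-d216's successor list «unramified `p = 2`,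
`f ≥ 2`: `log(𝒪^×)` is not a ball: Artin–Schreier»).  Nothing here is disputed mathematics; no IUT statement is
asserted. [cite: NeukirchANT1999, Ch. II Prop. (5.5)]
-/

noncomputable section

open Metric Set IsLocalRing
open scoped Pointwise

namespace Literature.IUT.LogVolume

namespace UnramifiedDyadic

open Literature.NumberTheory.GaloisRepresentations.Ultrametric

variable {K : Type*} [NontriviallyNormedField K] [NormedAlgebra ℚ_[2] K]

/-! ## 1. The terms of index `≥ 3` of the logarithmic series are `O(4)` on `2𝒪` -/

/-- `s + 2 ≤ m` whenever `2^s ∣ m` and `m ≥ 3`. [folklore] -/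
private theorem padicVal_add_two_le {m s : ℕ} (hm : 3 ≤ m) (h : 2 ^ s ∣ m) : s + 2 ≤ m := by
  have hle : 2 ^ s ≤ m := Nat.le_of_dvd (by omega) h
  rcases s with _ | _ | s
  · omega
  · omega
  · have key : ∀ t : ℕ, t + 2 + 2 ≤ 2 ^ (t + 2) := fun t => by
      induction t with
      | zero => norm_num
      | succ t ih => rw [pow_succ]; omega
    exact (key s).trans hle

/-- **Terms of index `n + 1 ≥ 3` on `‖x‖ ≤ 1/2` have norm `≤ 1/4`** (`(1/2)^{n+1}·2^{v₂(n+1)} ≤ (1/2)^{v+2}·2^v`).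
[cite: NeukirchANT1999, Ch. II Prop. (5.5)] -/
theorem norm_logTerm_le_quarter {x : K} (hx : ‖x‖ ≤ 2⁻¹) {n : ℕ} (hn : 2 ≤ n) :
    ‖-(x ^ (n + 1)) / (n + 1 : K)‖ ≤ 4⁻¹ := by
  have hkey : ∀ v : ℕ, (2⁻¹ : ℝ) ^ (v + 2) * (2 : ℝ) ^ v = 4⁻¹ := fun v => by
    rw [pow_add, mul_right_comm, ← mul_pow, inv_mul_cancel₀ (by norm_num : (2 : ℝ) ≠ 0), one_pow, one_mul]
    norm_num
  refine (WildDyadic.norm_logTerm_le x n).trans ?_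
  have hv := padicVal_add_two_le (m := n + 1) (s := padicValNat 2 (n + 1)) (by omega) pow_padicValNat_dvd
  calc ‖x‖ ^ (n + 1) * (2 : ℝ) ^ padicValNat 2 (n + 1)
      ≤ (2⁻¹ : ℝ) ^ (n + 1) * (2 : ℝ) ^ padicValNat 2 (n + 1) := by gcongr
    _ ≤ (2⁻¹ : ℝ) ^ (padicValNat 2 (n + 1) + 2) * (2 : ℝ) ^ padicValNat 2 (n + 1) := by
        gcongr ?_ * _
        exact pow_le_pow_of_le_one (by norm_num) (by norm_num) hv
    _ = 4⁻¹ := hkey _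

variable [IsUltrametricDist K] [CompleteSpace K]

/-- **`L(1 − 2w) ≡ −2·w·(1 + w) (mod 4)`**: for `‖w‖ ≤ 1`, `‖L(1 − 2w) + 2·w·(1 + w)‖ ≤ 1/4` — the first two terms
of the series are `−2w − 2w²`, the rest is `O(4)`. [cite: NeukirchANT1999, Ch. II Prop. (5.5)] -/
theorem norm_logSeries_add_le_quarter {w : K} (hw : ‖w‖ ≤ 1) :
    ‖logSeries (1 - 2 * w) + 2 * w * (1 + w)‖ ≤ 4⁻¹ := by
  set x : K := 2 * w with hxdef
  have hx : ‖x‖ ≤ 2⁻¹ := by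
    rw [hxdef, norm_mul, WildDyadic.norm_two]
    calc (2⁻¹ : ℝ) * ‖w‖ ≤ 2⁻¹ * 1 := by gcongr
      _ = 2⁻¹ := mul_one _
  have hy : ‖1 - (1 - x)‖ < 1 := by
    rw [sub_sub_cancel]; exact hx.trans_lt (by norm_num)
  set f : ℕ → K := fun n => -((1 - (1 - x)) ^ (n + 1)) / (n + 1 : K) with hfdef
  have hsum : HasSum f (logSeries (1 - x)) := hasSum_logSeries 2 hy
  have htail := (hasSum_nat_add_iff' 2).mpr hsum
  have hT : ‖logSeries (1 - x) - ∑ i ∈ Finset.range 2, f i‖ ≤ 4⁻¹ := by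
    rw [← htail.tsum_eq]
    refine IsUltrametricDist.norm_tsum_le_of_forall_le_of_nonneg (by norm_num) fun n => ?_
    show ‖-((1 - (1 - x)) ^ (n + 2 + 1)) / ((n + 2 : ℕ) + 1 : K)‖ ≤ 4⁻¹
    rw [sub_sub_cancel, show ((n + 2 : ℕ) + 1 : K) = ((n + 2 : ℕ) : K) + 1 by push_cast; ring]
    have := norm_logTerm_le_quarter hx (n := n + 2) (by omega)
    simpa using this
  have h2 : (2 : K) ≠ 0 := by
    rw [← norm_pos_iff, WildDyadic.norm_two]; norm_num
  have key : ((2 : K) * w) ^ 2 / 2 = 2 * w * w := by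
    rw [show ((2 : K) * w) ^ 2 = 2 * (2 * w * w) by ring, mul_div_cancel_left₀ _ h2]
  have h01 : ∑ i ∈ Finset.range 2, f i = -(2 * w) - ((2 : K) * w) ^ 2 / 2 := by
    rw [Finset.sum_range_succ, Finset.sum_range_succ, Finset.sum_range_zero, zero_add]
    simp only [hfdef, sub_sub_cancel, hxdef]
    push_cast
    ring
  have hrew : logSeries (1 - x) - (-(2 * w) - ((2 : K) * w) ^ 2 / 2) =
      logSeries (1 - 2 * w) + 2 * w * (1 + w) := by
    rw [key, hxdef]; ring
  rw [h01, hrew] at hT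
  exact hT

/-! ## 2. The residue field: characteristic `2`, Artin–Schreier is not onto, a third element when `f ≥ 2` -/

section Residue

open scoped NormedField

variable [ProperSpace K]

omit [CompleteSpace K] in
/-- `1 + 1 = 0` in the residue field of a `ℚ₂`-algebra (`‖2‖ < 1`). [cite: NeukirchANT1999, Ch. II Prop. (5.3)] -/
theorem one_add_one_residueField : (1 : ResidueField (Valued.integer K)) + 1 = 0 := by
  have h := residue_natCast_prime_eq_zero 2 K
  rw [Nat.cast_ofNat] at h
  rw [← h]; norm_num

omit [CompleteSpace K] in
/-- **Artin–Schreier is not onto**: `c ↦ c² + c` misses a value on the (finite) residue field, since it identifies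
`0` and `1`. [cite: NeukirchANT1999, Ch. II Prop. (5.3)] -/
theorem exists_not_mem_range_artinSchreier :
    ∃ a : ResidueField (Valued.integer K), ∀ c : ResidueField (Valued.integer K), c * c + c ≠ a := by
  haveI : Finite (ResidueField (Valued.integer K)) := finite_residueField
  have hnotinj : ¬ Function.Injective fun c : ResidueField (Valued.integer K) => c * c + c := by
    intro hinj
    have h := @hinj 0 1 (by simp only [mul_zero, zero_add, mul_one]; exact one_add_one_residueField.symm)
    exact zero_ne_one h
  have hnotsurj : ¬ Function.Surjective fun c : ResidueField (Valued.integer K) => c * c + c := by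
    rwa [← Finite.injective_iff_surjective]
  simpa [Function.Surjective] using hnotsurj

omit [CompleteSpace K] in
/-- **`f ≥ 2` ⇒ the residue field has an element `∉ {0, 1}`** (`#κ = 2^f ≥ 4`).
[cite: NeukirchANT1999, Ch. II Prop. (5.3)] -/
theorem exists_ne_zero_ne_one_residueField (hf : 2 ≤ residueDegree 2 K) :
    ∃ c : ResidueField (Valued.integer K), c ≠ 0 ∧ c ≠ 1 := by
  haveI : Finite (ResidueField (Valued.integer K)) := finite_residueField
  by_contra h
  push Not at h
  have hsub : (Set.univ : Set (ResidueField (Valued.integer K))) ⊆ {0, 1} := fun c _ => by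
    by_cases hc : c = 0
    · exact Or.inl hc
    · exact Or.inr (h c hc)
  have hcard : Nat.card (ResidueField (Valued.integer K)) ≤ 2 := by
    have h1 : (Set.univ : Set (ResidueField (Valued.integer K))).ncard ≤
        ({0, 1} : Set (ResidueField (Valued.integer K))).ncard := Set.ncard_le_ncard hsub (Set.toFinite _)
    rw [Set.ncard_univ] at h1
    exact h1.trans ((Set.ncard_insert_le _ _).trans (by rw [Set.ncard_singleton]))
  rw [card_residueField 2 K] at hcard
  have h4 : 2 ^ 2 ≤ 2 ^ residueDegree 2 K := Nat.pow_le_pow_right (by norm_num) hf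
  omega

omit [NormedAlgebra ℚ_[2] K] [CompleteSpace K] in
/-- Units of `𝒪` are the elements of nonzero residue: `‖w‖ = 1 ↔ residue w ≠ 0`.
[cite: NeukirchANT1999, Ch. II Prop. (5.3)] -/
theorem norm_eq_one_iff_residue_ne_zero (w : Valued.integer K) :
    ‖(w : K)‖ = 1 ↔ residue (Valued.integer K) w ≠ 0 := by
  rw [Ne, residue_eq_zero_iff, mem_maximalIdeal_iff_norm_lt_one]
  have h1 : ‖(w : K)‖ ≤ 1 := Valued.integer.mem_iff.mp w.2
  change _ ↔ ¬ ‖(w : K)‖ < 1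
  constructor
  · intro h; rw [h]; exact lt_irrefl 1
  · intro h; exact le_antisymm h1 (not_lt.mp h)

end Residue

/-! ## 3. `e = 1`: a unit logarithm of norm exactly `1/2`, and an element of `2𝒪` that is no unit logarithm -/

section Unramified

open scoped NormedField

variable [ProperSpace K]

omit [CompleteSpace K] in
/-- Discreteness at `e = 1`: `‖z‖ < 1 ⇒ ‖z‖ ≤ 1/2`. [cite: NeukirchANT1999, Ch. II Prop. (5.3)] -/
theorem norm_le_half_of_norm_lt_one (he : absRamificationIdx 2 K = 1) {z : K} (hz : ‖z‖ < 1) : ‖z‖ ≤ 2⁻¹ := by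
  have h := norm_le_rpow_of_norm_lt_one 2 K hz
  rw [he] at h
  push_cast at h
  rw [div_one, Real.rpow_neg_one] at h
  exact h

/-- **`e = 1`, `f ≥ 2` ⇒ some unit has `‖log₂ u‖ = 1/2` EXACTLY**: `u = 1 − 2w` with `w`, `1 + w` units
(residue `∉ {0, 1}`), `log₂ u ≡ −2w(1+w) (mod 4)`. [cite: NeukirchANT1999, Ch. II Prop. (5.5)] -/
theorem exists_norm_unitLog_eq_half (hf : 2 ≤ residueDegree 2 K) :
    ∃ u : K, ‖u‖ = 1 ∧ ‖unitLog u‖ = 2⁻¹ := by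
  obtain ⟨c, hc0, hc1⟩ := exists_ne_zero_ne_one_residueField (K := K) hf
  obtain ⟨w, hw⟩ := Ideal.Quotient.mk_surjective c
  have hwres : residue (Valued.integer K) w = c := hw
  have hw1 : ‖(w : K)‖ = 1 := (norm_eq_one_iff_residue_ne_zero w).mpr (by rw [hwres]; exact hc0)
  have hw1' : ‖(1 : K) + w‖ = 1 := by
    have h := (norm_eq_one_iff_residue_ne_zero (1 + w)).mpr (by
      rw [map_add, map_one, hwres]
      intro h0
      apply hc1
      have h2 : c = -1 := eq_neg_of_add_eq_zero_right h0
      rw [h2, neg_eq_iff_add_eq_zero, one_add_one_residueField])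
    simpa using h
  have h2w : ‖(2 : K) * w‖ = 2⁻¹ := by rw [norm_mul, WildDyadic.norm_two, hw1, mul_one]
  refine ⟨1 - 2 * w, ?_, ?_⟩
  · -- `‖1 - 2w‖ = 1`
    have hlt : ‖(2 : K) * w‖ < ‖(1 : K)‖ := by rw [h2w, norm_one]; norm_num
    rw [sub_eq_add_neg, IsUltrametricDist.norm_add_eq_max_of_norm_ne_norm (by rw [norm_neg]; exact hlt.ne'),
      norm_neg, norm_one, max_eq_left (by rw [h2w]; norm_num)]
  · have hP : IsPrincipal (1 - 2 * (w : K)) := by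
      show ‖1 - (1 - 2 * (w : K))‖ < 1
      rw [sub_sub_cancel, h2w]; norm_num
    rw [unitLog_of_isPrincipal 2 hP]
    have hmain : ‖(2 : K) * w * (1 + w)‖ = 2⁻¹ := by rw [norm_mul, h2w, hw1', mul_one]
    have hle := norm_logSeries_add_le_quarter (K := K) (w := w) hw1.le
    -- `L = (L + 2w(1+w)) - 2w(1+w)`, norms `≤ 1/4` and `= 1/2`
    have hne : ‖logSeries (1 - 2 * (w : K)) + 2 * w * (1 + w)‖ ≠ ‖-(2 * (w : K) * (1 + w))‖ := by
      rw [norm_neg, hmain]; exact (hle.trans_lt (by norm_num)).ne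
    have h := IsUltrametricDist.norm_add_eq_max_of_norm_ne_norm hne
    rw [add_neg_cancel_right, norm_neg, hmain] at h
    rw [h, max_eq_right (hle.trans (by norm_num))]

/-- **`e = 1` ⇒ some `z` with `‖z‖ ≤ 1/2` is NO unit logarithm**: `z = 2w₀` with residue of `w₀` outside
`℘(κ)`; were `2w₀ = log₂ u`, an odd power `u^m = 1 − 2w` would give `m·w₀ + w + w² ≡ 0 (mod 2)`, i.e.
`℘(w̄) = w̄₀`. [cite: NeukirchANT1999, Ch. II Prop. (5.5)] -/
theorem exists_norm_le_half_not_mem_logUnits (he : absRamificationIdx 2 K = 1) :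
    ∃ z : K, ‖z‖ ≤ 2⁻¹ ∧ z ∉ logUnits K := by
  obtain ⟨a, ha⟩ := exists_not_mem_range_artinSchreier (K := K)
  obtain ⟨w₀, hw₀⟩ := Ideal.Quotient.mk_surjective a
  have hw₀res : residue (Valued.integer K) w₀ = a := hw₀
  have hw₀1 : ‖(w₀ : K)‖ ≤ 1 := Valued.integer.mem_iff.mp w₀.2
  refine ⟨2 * w₀, ?_, ?_⟩
  · rw [norm_mul, WildDyadic.norm_two]
    calc (2⁻¹ : ℝ) * ‖(w₀ : K)‖ ≤ 2⁻¹ * 1 := by gcongr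
      _ = 2⁻¹ := mul_one _
  rintro ⟨u, hu, hlog⟩
  change ‖u‖ = 1 at hu
  -- an odd power of `u` is principal: `u^m = 1 - 2w`
  obtain ⟨m, hm0, hm2, hmP⟩ := exists_pow_isPrincipal_not_dvd (p := 2) hu
  have hx : ‖1 - u ^ m‖ ≤ 2⁻¹ := norm_le_half_of_norm_lt_one he hmP
  have h2 : (2 : K) ≠ 0 := by rw [← norm_pos_iff, WildDyadic.norm_two]; norm_num
  set w : K := (1 - u ^ m) / 2 with hwdef
  have hw1 : ‖w‖ ≤ 1 := by
    rw [hwdef, norm_div, WildDyadic.norm_two, div_le_iff₀ (by norm_num : (0 : ℝ) < 2⁻¹), one_mul]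
    exact hx
  have hum : u ^ m = 1 - 2 * w := by rw [hwdef]; field_simp; ring
  -- `log₂(u^m) = m · 2w₀`
  have hlogm : logSeries (1 - 2 * w) = (m : K) * (2 * w₀) := by
    rw [← hum, ← unitLog_of_isPrincipal 2 hmP, unitLog_pow 2 hu m, hlog]
  -- so `‖2 (m w₀ + w (1 + w))‖ ≤ 1/4`, i.e. `‖m w₀ + w(1+w)‖ ≤ 1/2 < 1`
  have hle := norm_logSeries_add_le_quarter (K := K) hw1
  rw [hlogm, show (m : K) * (2 * w₀) + 2 * w * (1 + w) = 2 * ((m : K) * w₀ + w * (1 + w)) by ring,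
    norm_mul, WildDyadic.norm_two] at hle
  have hlt : ‖(m : K) * w₀ + w * (1 + w)‖ < 1 := by
    have : ‖(m : K) * w₀ + w * (1 + w)‖ ≤ 2⁻¹ := by
      have h4 : (4⁻¹ : ℝ) = 2⁻¹ * 2⁻¹ := by norm_num
      rw [h4] at hle
      exact le_of_mul_le_mul_left hle (by norm_num)
    exact this.trans_lt (by norm_num)
  -- read in the residue field: `m̄ a + c(1+c) = 0` with `m̄ = 1`
  let wI : Valued.integer K := ⟨w, Valued.integer.mem_iff.mpr hw1⟩
  have hmem : (⟨(m : K) * w₀ + w * (1 + w), Valued.integer.mem_iff.mpr hlt.le⟩ : Valued.integer K) ∈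
      maximalIdeal (Valued.integer K) := by
    rw [mem_maximalIdeal_iff_norm_lt_one]; exact hlt
  rw [← residue_eq_zero_iff] at hmem
  have hcalc : (⟨(m : K) * w₀ + w * (1 + w), Valued.integer.mem_iff.mpr hlt.le⟩ : Valued.integer K) =
      (m : Valued.integer K) * w₀ + wI * (1 + wI) := by
    apply Subtype.ext
    simp [wI]
  rw [hcalc, map_add, map_mul, map_mul, map_add, map_one, map_natCast, hw₀res] at hmem
  -- `m` odd ⇒ `(m : κ) = 1`
  have hmodd : (m : ResidueField (Valued.integer K)) = 1 := by
    obtain ⟨k, hk⟩ := Nat.odd_iff.mpr (Nat.two_dvd_ne_zero.mp hm2)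
    rw [hk]
    push_cast
    rw [show (2 : ResidueField (Valued.integer K)) = 1 + 1 by norm_num, one_add_one_residueField, zero_mul,
      zero_add]
  rw [hmodd, one_mul] at hmem
  -- `a = -(c(1+c)) = c*c + c` in characteristic `2`
  set c := residue (Valued.integer K) wI
  apply ha c
  have hneg : ∀ t : ResidueField (Valued.integer K), -t = t := fun t => by
    have : t + t = 0 := by
      rw [← two_mul, show (2 : ResidueField (Valued.integer K)) = 1 + 1 by norm_num, one_add_one_residueField,
        zero_mul]
    exact (neg_eq_of_add_eq_zero_left this)
  have ha' : a = -(c * (1 + c)) := eq_neg_of_add_eq_zero_left hmem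
  rw [ha', hneg]; ring

/-! ## 4. `e = 1`, `f ≥ 2`: `log₂(𝒪^×)` is no ball -/

/-- **`e(K/ℚ₂) = 1`, `f(K/ℚ₂) ≥ 2` ⇒ `log₂(𝒪_K^×)` is NOT a ball `{‖y‖ ≤ r}`**: a unit logarithm of norm `1/2`
forces `r ≥ 1/2`, an element of `2𝒪` outside forces `r < 1/2`. [cite: NeukirchANT1999, Ch. II Prop. (5.5)] -/
theorem logUnits_ne_closedBall (he : absRamificationIdx 2 K = 1) (hf : 2 ≤ residueDegree 2 K) (r : ℝ) :
    logUnits K ≠ closedBall (0 : K) r := by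
  intro h
  obtain ⟨u, hu, hlog⟩ := exists_norm_unitLog_eq_half (K := K) hf
  obtain ⟨z, hz, hzΛ⟩ := exists_norm_le_half_not_mem_logUnits (K := K) he
  have h1 : unitLog u ∈ closedBall (0 : K) r := h ▸ ⟨u, hu, rfl⟩
  rw [mem_closedBall_zero_iff, hlog] at h1
  apply hzΛ
  rw [h, mem_closedBall_zero_iff]
  exact hz.trans h1

/-- **`𝒪_K ≠ 2^k · log₂(𝒪_K^×)` for every `k ∈ ℤ`** at `e = 1`, `f ≥ 2` (else `log₂(𝒪_K^×) = 2^{−k}·𝒪_K` would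
be a ball). [cite: NeukirchANT1999, Ch. II Prop. (5.5)] -/
theorem closedBall_one_ne_zpow_smul_logUnits (he : absRamificationIdx 2 K = 1) (hf : 2 ≤ residueDegree 2 K)
    (k : ℤ) : closedBall (0 : K) 1 ≠ ((2 : ℚ_[2]) ^ k) • logUnits K := by
  intro h
  have h2 : ((2 : ℚ_[2]) ^ k) ≠ 0 := zpow_ne_zero _ (by norm_num)
  have hball : ((2 : ℚ_[2]) ^ k)⁻¹ • closedBall (0 : K) 1 = closedBall 0 (‖((2 : ℚ_[2]) ^ k)⁻¹‖ * 1) := by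
    rw [smul_closedBall' (inv_ne_zero h2), smul_zero]
  apply logUnits_ne_closedBall he hf (‖((2 : ℚ_[2]) ^ k)⁻¹‖ * 1)
  rw [← hball, h, smul_smul, inv_mul_cancel₀ h2, one_smul]

/-- The same for every ball `{‖y‖ ≤ ‖t‖}`: none is a `2^k · log₂(𝒪_K^×)`.
[cite: NeukirchANT1999, Ch. II Prop. (5.5)] -/
theorem closedBall_ne_zpow_smul_logUnits (he : absRamificationIdx 2 K = 1) (hf : 2 ≤ residueDegree 2 K)
    (t : K) (k : ℤ) : closedBall (0 : K) ‖t‖ ≠ ((2 : ℚ_[2]) ^ k) • logUnits K := by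
  intro h
  have h2 : ((2 : ℚ_[2]) ^ k) ≠ 0 := zpow_ne_zero _ (by norm_num)
  have hball : ((2 : ℚ_[2]) ^ k)⁻¹ • closedBall (0 : K) ‖t‖ = closedBall 0 (‖((2 : ℚ_[2]) ^ k)⁻¹‖ * ‖t‖) := by
    rw [smul_closedBall' (inv_ne_zero h2), smul_zero]
  apply logUnits_ne_closedBall he hf (‖((2 : ℚ_[2]) ^ k)⁻¹‖ * ‖t‖)
  rw [← hball, h, smul_smul, inv_mul_cancel₀ h2, one_smul]

end Unramified

end UnramifiedDyadic

end Literature.IUT.LogVolume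

end
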